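import Summits.CriticalPhenomena.PercolationContinuityZ3.Theorems.PercNearOneGluingNoHeavyLowerTailFrontierDecRowsRow36ThreeOneCutAll
import Summits.CriticalPhenomena.PercolationContinuityZ3.Theorems.PercNearOneGluingNoHeavyLowerTailFrontierDecRowsRow36CutVertex
import Summits.CriticalPhenomena.PercolationContinuityZ3.Theorems.PercNearOneGluingNoHeavyLowerTailFrontierDecRowsRow36CutVertexAB
import Summits.CriticalPhenomena.PercolationContinuityZ3.Theorems.PercNearOneGluingNoHeavyLowerTailFrontierDecRowsRow36CutVertexAY
import Summits.CriticalPhenomena.PercolationContinuityZ3.Theorems.PercNearOneGluingNoHeavyLowerTailFrontierDecRowsSideRestriction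
import HarnessLib

/-!
# Frontier dec row 36 reduces to weighted graphs WITHOUT a cut vertex

Support file for crux `stmt-CriticalPhenomena-4575` (four-point decreasing `E₃` frontier), seat `prim-l12-p6` gen 15; memo
`run/shared/lean/prim/prim-l12/FROM-prim-l12-p6-g15-ROW44-CUT-VERTICES.md` §8.4.  No definitions, no named facts, no sorries.
The row-36 twin of `frontier_44_all_of_noCut` (`…Row44NoCutVertex`), same proof word for word with the row-36 cut theorems:
`2|2` splits `sahiE3_row36_nonneg_of_cutVertex` (gen 14, `{a,c}|{b,y}`), `…_of_cutVertexAB` (`{a,b}|{c,y}`), `…_of_cutVertexAY` (`{a,y}|{b,c}`),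
`3|1` splits `sahiE3_row36_nonneg_of_threeOneCut_a/_b/_c/_y` (replace the lone terminal by `h`, then delete its side with
`sahiE3_sep_restrictSide`), `4|0` by restriction.  THEOREM (`frontier_36_all_of_noCut`): if row 36 `E₃(D[a|b], D[a|c], D[b|y]) ≥ 0` holds for
every weight admitting NO cut colouring, it holds on every finite weighted graph.
-/

noncomputable section

namespace Summit.CriticalPhenomena.PercolationContinuityZ3.Theorems.FrontierDecRows

open MeasureTheory CovTransferCert E3GroupSepCert
open Literature.Probability.Percolation Literature.Probability.LatticeModels

variable {n : ℕ}

/-- **Row 36 reduces to cut-free weighted graphs.**  If `E₃(D[a|b], D[a|c], D[b|y]) ≥ 0` at every placement on every finite weighted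
graph whose weight admits no cut colouring, then it holds at every placement on every finite weighted graph. [this work] -/
theorem frontier_36_all_of_noCut
    (H : ∀ (n : ℕ) (w : Sym2 (Fin n) → unitInterval) (a b c y : Fin n),
      (∀ (h : Fin n) (side : Fin n → Bool), (∀ u v : Fin n, u ≠ h → v ≠ h → side u ≠ side v → w s(u, v) = 0) →
        (∃ u v : Fin n, u ≠ h ∧ side u = true ∧ 0 < (w s(u, v) : ℝ)) →
        (∃ u v : Fin n, u ≠ h ∧ side u = false ∧ 0 < (w s(u, v) : ℝ)) → False) →
      0 ≤ sahiE3 (prodBernoulli w) (connEvent (row 36 n (a, b, c, y)).1) (connEvent (row 36 n (a, b, c, y)).2.1)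
        (connEvent (row 36 n (a, b, c, y)).2.2))
    (n : ℕ) (w : Sym2 (Fin n) → unitInterval) (a b c y : Fin n) :
    0 ≤ sahiE3 (prodBernoulli w) (connEvent (row 36 n (a, b, c, y)).1) (connEvent (row 36 n (a, b, c, y)).2.1)
      (connEvent (row 36 n (a, b, c, y)).2.2) := by
  classical
  -- induction on the number of positive-weight edges
  suffices main : ∀ (m : ℕ) (w : Sym2 (Fin n) → unitInterval) (a b c y : Fin n),
      (Finset.univ.filter (fun e : Sym2 (Fin n) => 0 < (w e : ℝ))).card ≤ m →
      0 ≤ sahiE3 (prodBernoulli w) (connEvent (row 36 n (a, b, c, y)).1) (connEvent (row 36 n (a, b, c, y)).2.1)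
        (connEvent (row 36 n (a, b, c, y)).2.2) from main _ w a b c y le_rfl
  intro m
  induction m with
  | zero =>
    intro w a b c y hm
    -- no positive edge: no cut colouring exists
    refine H n w a b c y fun h side _ h1 _ => ?_
    obtain ⟨u, v, _, _, huv⟩ := h1
    have : s(u, v) ∈ Finset.univ.filter (fun e : Sym2 (Fin n) => 0 < (w e : ℝ)) := Finset.mem_filter.2 ⟨Finset.mem_univ _, huv⟩
    rw [Nat.le_zero, Finset.card_eq_zero] at hm
    rw [hm] at this; exact absurd this (Finset.notMem_empty _)
  | succ m ih =>
    intro w a b c y hm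
    by_cases hcut : ∃ (h : Fin n) (side : Fin n → Bool), (∀ u v : Fin n, u ≠ h → v ≠ h → side u ≠ side v → w s(u, v) = 0) ∧
        (∃ u v : Fin n, u ≠ h ∧ side u = true ∧ 0 < (w s(u, v) : ℝ)) ∧
        (∃ u v : Fin n, u ≠ h ∧ side u = false ∧ 0 < (w s(u, v) : ℝ))
    swap
    · exact H n w a b c y fun h side hw h1 h2 => hcut ⟨h, side, hw, h1, h2⟩
    obtain ⟨h, side₀, hw₀, hpos₀, hneg₀⟩ := hcut
    -- the restriction step: delete everything outside the `true` side of a colouring `sd`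
    have restrict : ∀ (sd : Fin n → Bool), (∀ u v : Fin n, u ≠ h → v ≠ h → sd u ≠ sd v → w s(u, v) = 0) →
        (∃ u v : Fin n, u ≠ h ∧ sd u = false ∧ 0 < (w s(u, v) : ℝ)) →
        ∀ a' b' c' y' : Fin n, (∀ x ∈ [a', b', c', y'], sd x = true ∨ x = h) →
        0 ≤ sahiE3 (prodBernoulli w) (connEvent (row 36 n (a', b', c', y')).1) (connEvent (row 36 n (a', b', c', y')).2.1)
          (connEvent (row 36 n (a', b', c', y')).2.2) := by
      intro sd hsd hfalse a' b' c' y' hpts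
      have hrow : row 36 n (a', b', c', y') = (sep [a'] [b'], sep [a'] [c'], sep [b'] [y']) := rfl
      rw [hrow]
      have hpts' : ∀ x ∈ [a'] ++ [b'] ++ [a'] ++ [c'] ++ [b'] ++ [y'], sd x = true ∨ x = h := by
        intro x hx
        apply hpts x
        simp only [List.mem_append, List.mem_cons, List.mem_nil_iff, or_false] at hx ⊢
        tauto
      rw [sahiE3_sep_restrictSide w h sd hsd [a'] [b'] [a'] [c'] [b'] [y'] hpts']
      set F₁ : Finset (Sym2 (Fin n)) := Finset.univ.filter (fun e : Sym2 (Fin n) => ∀ u ∈ e, sd u = true ∨ u = h) with hF₁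
      set w' : Sym2 (Fin n) → unitInterval := fun e => if e ∈ (↑F₁ : Set (Sym2 (Fin n))) then w e else 0 with hw'
      apply ih w' a' b' c' y'
      -- the positive edges of `w'` form a proper subset of those of `w`
      obtain ⟨u, v, huh, hsu, huv⟩ := hfalse
      have hsub : Finset.univ.filter (fun e : Sym2 (Fin n) => 0 < (w' e : ℝ)) ⊂
          Finset.univ.filter (fun e : Sym2 (Fin n) => 0 < (w e : ℝ)) := by
        rw [Finset.ssubset_iff_subset_ne]
        refine ⟨fun e he => ?_, fun heq => ?_⟩
        · rw [Finset.mem_filter] at he ⊢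
          refine ⟨Finset.mem_univ _, ?_⟩
          have := he.2
          simp only [hw'] at this
          split_ifs at this with hmem
          · exact this
          · simp at this
        · have hin : s(u, v) ∈ Finset.univ.filter (fun e : Sym2 (Fin n) => 0 < (w e : ℝ)) :=
            Finset.mem_filter.2 ⟨Finset.mem_univ _, huv⟩
          rw [← heq, Finset.mem_filter] at hin
          have hnot : s(u, v) ∉ F₁ := by
            rw [hF₁, Finset.mem_filter]
            intro hmem
            rcases hmem.2 u (Sym2.mem_iff.2 (Or.inl rfl)) with h1 | h1
            · rw [hsu] at h1; exact Bool.false_ne_true h1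
            · exact huh h1
          have : (w' s(u, v) : ℝ) = 0 := by
            simp only [hw', Finset.mem_coe]
            rw [if_neg hnot]; rfl
          linarith [hin.2]
      have := Finset.card_lt_card hsub
      omega
    -- colour flips keep the hypotheses
    have flip : ∀ (sd : Fin n → Bool), (∀ u v : Fin n, u ≠ h → v ≠ h → sd u ≠ sd v → w s(u, v) = 0) →
        ∀ u v : Fin n, u ≠ h → v ≠ h → (fun x => !sd x) u ≠ (fun x => !sd x) v → w s(u, v) = 0 :=
      fun sd hsd u v hu hv hne => hsd u v hu hv (fun e => hne (by simp only [e]))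
    have hw₁ := flip side₀ hw₀
    have hneg₁ : ∃ u v : Fin n, u ≠ h ∧ (fun x => !side₀ x) u = false ∧ 0 < (w s(u, v) : ℝ) := by
      obtain ⟨u, v, hu, hs, hp⟩ := hpos₀; exact ⟨u, v, hu, by simp [hs], hp⟩
    have hpos₁ : ∃ u v : Fin n, u ≠ h ∧ (fun x => !side₀ x) u = true ∧ 0 < (w s(u, v) : ℝ) := by
      obtain ⟨u, v, hu, hs, hp⟩ := hneg₀; exact ⟨u, v, hu, by simp [hs], hp⟩
    -- recolouring `h` keeps the hypotheses
    have recol : ∀ (sd : Fin n → Bool) (X : Bool), (∀ u v : Fin n, u ≠ h → v ≠ h → sd u ≠ sd v → w s(u, v) = 0) →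
        ∀ u v : Fin n, u ≠ h → v ≠ h → Function.update sd h X u ≠ Function.update sd h X v → w s(u, v) = 0 :=
      fun sd X hsd u v hu hv hne => hsd u v hu hv (by rwa [Function.update_of_ne hu, Function.update_of_ne hv] at hne)
    have recol_false : ∀ (sd : Fin n → Bool) (X : Bool), (∃ u v : Fin n, u ≠ h ∧ sd u = false ∧ 0 < (w s(u, v) : ℝ)) →
        ∃ u v : Fin n, u ≠ h ∧ Function.update sd h X u = false ∧ 0 < (w s(u, v) : ℝ) :=
      fun sd X ⟨u, v, hu, hs, hp⟩ => ⟨u, v, hu, by rw [Function.update_of_ne hu]; exact hs, hp⟩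
    -- a terminal equal to `h` can be given any colour: helper producing "true or = h" lists
    have mk4 : ∀ (sd : Fin n → Bool) (p q r s : Fin n),
        (sd p = true ∨ p = h) → (sd q = true ∨ q = h) → (sd r = true ∨ r = h) → (sd s = true ∨ s = h) →
        ∀ x ∈ [p, q, r, s], sd x = true ∨ x = h := by
      intro sd p q r s hp hq hr hs x hx
      simp only [List.mem_cons, List.mem_nil_iff, or_false] at hx
      rcases hx with rfl | rfl | rfl | rfl <;> assumption
    -- case analysis on the colours of the four terminals (under `side₀`)
    rcases ha : side₀ a with _ | _ <;> rcases hb : side₀ b with _ | _ <;> rcases hc : side₀ c with _ | _ <;>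
      rcases hy : side₀ y with _ | _
    · -- FFFF: delete the `true` side (use the flipped colouring)
      exact restrict _ hw₁ hneg₁ a b c y (mk4 _ a b c y (Or.inl (by simp [ha])) (Or.inl (by simp [hb]))
        (Or.inl (by simp [hc])) (Or.inl (by simp [hy])))
    · -- FFFT: lone `y` true
      by_cases hyh : y = h
      · exact restrict _ hw₁ hneg₁ a b c y (mk4 _ a b c y (Or.inl (by simp [ha])) (Or.inl (by simp [hb]))
          (Or.inl (by simp [hc])) (Or.inr hyh))
      · refine sahiE3_row36_nonneg_of_threeOneCut_y w a b c y h (fun x => !side₀ x) (by simp [ha]) (by simp [hb]) (by simp [hc])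
          (by simp [hy]) hw₁ ?_
        exact restrict _ hw₁ hneg₁ a b c h (mk4 _ a b c h (Or.inl (by simp [ha])) (Or.inl (by simp [hb]))
          (Or.inl (by simp [hc])) (Or.inr rfl))
    · -- FFTF: lone `c` true
      by_cases hch : c = h
      · exact restrict _ hw₁ hneg₁ a b c y (mk4 _ a b c y (Or.inl (by simp [ha])) (Or.inl (by simp [hb])) (Or.inr hch)
          (Or.inl (by simp [hy])))
      · refine sahiE3_row36_nonneg_of_threeOneCut_c w a b c y h (fun x => !side₀ x) (by simp [ha]) (by simp [hb]) (by simp [hy])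
          (by simp [hc]) hw₁ ?_
        exact restrict _ hw₁ hneg₁ a b h y (mk4 _ a b h y (Or.inl (by simp [ha])) (Or.inl (by simp [hb])) (Or.inr rfl)
          (Or.inl (by simp [hy])))
    · -- FFTT: {a,b} false | {c,y} true: the `AB` theorem with the flipped colouring
      exact sahiE3_row36_nonneg_of_cutVertexAB w a b c y h (fun x => !side₀ x) (by simp [ha]) (by simp [hb]) (by simp [hc])
        (by simp [hy]) hw₁
    · -- FTFF: lone `b` true
      by_cases hbh : b = h
      · exact restrict _ hw₁ hneg₁ a b c y (mk4 _ a b c y (Or.inl (by simp [ha])) (Or.inr hbh) (Or.inl (by simp [hc]))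
          (Or.inl (by simp [hy])))
      · refine sahiE3_row36_nonneg_of_threeOneCut_b w a b c y h (fun x => !side₀ x) (by simp [ha]) (by simp [hc]) (by simp [hy])
          (by simp [hb]) hw₁ ?_
        exact restrict _ hw₁ hneg₁ a h c y (mk4 _ a h c y (Or.inl (by simp [ha])) (Or.inr rfl) (Or.inl (by simp [hc]))
          (Or.inl (by simp [hy])))
    · -- FTFT: {a,c} false | {b,y} true: gen-14 theorem with the flipped colouring
      exact sahiE3_row36_nonneg_of_cutVertex w a b c y h (fun x => !side₀ x) (by simp [ha]) (by simp [hc]) (by simp [hb])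
        (by simp [hy]) hw₁
    · -- FTTF: {a,y} false | {b,c} true: the `AY` theorem with the flipped colouring
      exact sahiE3_row36_nonneg_of_cutVertexAY w a b c y h (fun x => !side₀ x) (by simp [ha]) (by simp [hy]) (by simp [hb])
        (by simp [hc]) hw₁
    · -- FTTT: lone `a` false
      by_cases hah : a = h
      · exact restrict _ hw₀ hneg₀ a b c y (mk4 _ a b c y (Or.inr hah) (Or.inl hb) (Or.inl hc) (Or.inl hy))
      · refine sahiE3_row36_nonneg_of_threeOneCut_a w a b c y h side₀ hb hc hy ha hw₀ ?_
        exact restrict _ hw₀ hneg₀ h b c y (mk4 _ h b c y (Or.inr rfl) (Or.inl hb) (Or.inl hc) (Or.inl hy))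
    · -- TFFF: lone `a` true
      by_cases hah : a = h
      · exact restrict _ hw₁ hneg₁ a b c y (mk4 _ a b c y (Or.inr hah) (Or.inl (by simp [hb])) (Or.inl (by simp [hc]))
          (Or.inl (by simp [hy])))
      · refine sahiE3_row36_nonneg_of_threeOneCut_a w a b c y h (fun x => !side₀ x) (by simp [hb]) (by simp [hc]) (by simp [hy])
          (by simp [ha]) hw₁ ?_
        exact restrict _ hw₁ hneg₁ h b c y (mk4 _ h b c y (Or.inr rfl) (Or.inl (by simp [hb])) (Or.inl (by simp [hc]))
          (Or.inl (by simp [hy])))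
    · -- TFFT: {a,y} true | {b,c} false: the `AY` theorem
      exact sahiE3_row36_nonneg_of_cutVertexAY w a b c y h side₀ ha hy hb hc hw₀
    · -- TFTF: {a,c} true | {b,y} false: gen-14 theorem
      exact sahiE3_row36_nonneg_of_cutVertex w a b c y h side₀ ha hc hb hy hw₀
    · -- TFTT: lone `b` false
      by_cases hbh : b = h
      · exact restrict _ hw₀ hneg₀ a b c y (mk4 _ a b c y (Or.inl ha) (Or.inr hbh) (Or.inl hc) (Or.inl hy))
      · refine sahiE3_row36_nonneg_of_threeOneCut_b w a b c y h side₀ ha hc hy hb hw₀ ?_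
        exact restrict _ hw₀ hneg₀ a h c y (mk4 _ a h c y (Or.inl ha) (Or.inr rfl) (Or.inl hc) (Or.inl hy))
    · -- TTFF: the `AB` theorem
      exact sahiE3_row36_nonneg_of_cutVertexAB w a b c y h side₀ ha hb hc hy hw₀
    · -- TTFT: lone `c` false
      by_cases hch : c = h
      · exact restrict _ hw₀ hneg₀ a b c y (mk4 _ a b c y (Or.inl ha) (Or.inl hb) (Or.inr hch) (Or.inl hy))
      · refine sahiE3_row36_nonneg_of_threeOneCut_c w a b c y h side₀ ha hb hy hc hw₀ ?_
        exact restrict _ hw₀ hneg₀ a b h y (mk4 _ a b h y (Or.inl ha) (Or.inl hb) (Or.inr rfl) (Or.inl hy))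
    · -- TTTF: lone `y` false
      by_cases hyh : y = h
      · exact restrict _ hw₀ hneg₀ a b c y (mk4 _ a b c y (Or.inl ha) (Or.inl hb) (Or.inl hc) (Or.inr hyh))
      · refine sahiE3_row36_nonneg_of_threeOneCut_y w a b c y h side₀ ha hb hc hy hw₀ ?_
        exact restrict _ hw₀ hneg₀ a b c h (mk4 _ a b c h (Or.inl ha) (Or.inl hb) (Or.inl hc) (Or.inr rfl))
    · -- TTTT: delete the `false` side
      exact restrict _ hw₀ hneg₀ a b c y (mk4 _ a b c y (Or.inl ha) (Or.inl hb) (Or.inl hc) (Or.inl hy))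

end Summit.CriticalPhenomena.PercolationContinuityZ3.Theorems.FrontierDecRows
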